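import Summits.BirchSwinnertonDyer.BirchSwinnertonDyer.Theorems.PrintX11aNonSurjEulerHalfOfMu
import Summits.BirchSwinnertonDyer.BirchSwinnertonDyer.Theorems.PrintX11aNonSurjMuAnHardDefs
import Literature.NumberTheory.EllipticCurves.Rank1Residual.CyclotomicWindingSpan
import Literature.NumberTheory.EllipticCurves.Rank1Residual.MuLambdaCarriers
import Summits.BirchSwinnertonDyer.BirchSwinnertonDyer.Theorems.PrintX11aMuCosetDoorUnit
import Summits.BirchSwinnertonDyer.Rank1Residual.Additive.PlusSymbolIntegrality
import Summits.BirchSwinnertonDyer.BirchSwinnertonDyer.Theorems.PrintX11aMultThreeWinding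
import Summits.BirchSwinnertonDyer.BirchSwinnertonDyer.Theorems.SmallImageMuTransferAnalyticMuZeroX9TeichSpanOrbitHecke
import HarnessLib

/-!
# Line «multspan3» for the child crux U3 = `PrintX11a.UpperNonSurjThree` (item stmt-BirchSwinnertonDyer-20613)
# of route `route-BirchSwinnertonDyer-PrintX11a` — ideator seat bsd-idea-17 (lens «transfer»), 2026-08-28

BSD is not proved by any of this; nothing is asserted about any curve; the four `sorry`s below are the
registered stubs; the two compositions (`muAnHardThree_of_multSpan`, `UpperNonSurjThree_of`) are real proofs.

## The transfer (solved sibling ⟶ this crux)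

SOLVED SIBLING (in the tree, input-free): `Rank1Residual.AnalyticMuZeroThree.muAnZeroAt_three` — for `E/ℚ` with GOOD
ORDINARY reduction at `3` and `E[3]` irreducible, `μ(L₃(E)) = 0` — via THEOREM B (`ConjSpanGen N 3` at every level
`3 ∤ N`, proved from Vaserstein's relative presentation `SL2Rel.Away`) ⟹ the generic Stevens bridge
(`PrintX8VerticalStevens.exists_mem_one_le_norm_sub_of_spanModBy_of_prime`: span mod `p` by a test set `S` up to
Eisenstein + ONE Hecke prime `ℓ ∤ N` with `a_ℓ ≢ ℓ + 1 (mod p)` ⟹ some `γ ∈ S` has `[γ0]⁺ ≢ [0]⁺ (mod p)`; its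
docstring records that `p ∤ N` is NOT needed) ⟹ `CycWindingNonConstantAt W 3` ⟹ `CollapseThree` ⟹ the `ω⁰` branch.

THIS CRUX lives at MULTIPLICATIVE `3` (`3 ∥ N`, X11a).  Dictionary (object ↦ object):
* level `N`, `3 ∤ N` ↦ level `N = 3M`, `3 ∤ M` (`IsNewformOf.dvd_level_and_not_sq_dvd_of_multiplicative`);
* the cusp class of `0` (all `b/3^m`) ↦ the cusp class of `1/3` (all `u/3^k`, `k ≥ 1`, `3 ∤ u`, are `Γ₀(3M)`-equivalent);
* GOOD element `|d(γ)| = 3^m` (⟺ `γ·0 = b/3^m`) ↦ MULT-GOOD element `|c(γ) + 3·d(γ)| = 3^{m+1}` (⟺ `γ·(1/3) = u/3^{m+1}`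
  reduced, `3 ∤ u`; equivalently `γ ↦ T⁻¹·diag(3,1)·γ·diag(3,1)⁻¹·T` carries `Γ₀(3M)` onto the level-`3M` group
  `{g ∈ Γ₀(M) : a + c ≡ b + d (mod 3)}` and mult-good onto good) — `IsMultGoodAt` below;
* `Γ_H(N)`, `H = ⟨±1, 3⟩` ↦ `Γ₁'(3M)` (at `3 ∣ N` the condition `d ≡ ±3^k` forces `k = 0`) — the tree's `SpanModBy` is already
  phrased with `Gamma1'`;
* the closed class `{0 → γ0}` with `m(γ)/2 = [γ0]⁺ − [0]⁺` ↦ the closed class `{1/3 → γ(1/3)}` with the SAME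
  `m(γ)/2 = [γ(1/3)]⁺ − [1/3]⁺ = [u/3^{m+1}]⁺ − [1/3]⁺` (`{∞→γr} − {∞→r} = {∞→γ∞}` for every `r`);
* unit root `α` + two-root MSD measure ↦ `a₃ = ±1` + the ONE-root measure `μ(a + 3ⁿℤ₃) = a₃^{-n}[a/3ⁿ]⁺`
  (`IsMultPAdicLFunctionOf`, `.unique`, the Riemann-sum certificates) — EASIER: no stabilisation, every `[u/3^k]⁺`
  with `k ≥ 1` IS a measure value up to sign, so ONE unit symbol of level `≥ 1` gives `μ = 0` directly (no collapse step).
FIRST NON-TRANSFERRING STEP = THEOREM B at level `3M` for the mult-good test set: `stub_multSpanMod_three`.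

## Stubs (3) and compositions (v3: S3 is REAL — orbit unit ⟹ μ PROVED class-wide through the cell's coset door; v2 after critic V#5: S2 delivers the orbit-unit carrier)
S1 `stub_multSpanMod_three` (THE crux of the line: Theorem B^{mult}; CENSUS by this seat, exact Manin symbols mod 3: the strong form
«classes {1/3 → u/3^{m+1}}, m ≤ 4, span ALL of H₁(X₀(3M);𝔽₃)» holds at 21/21 levels 3M ≤ 141) · S2 `stub_orbitUnit_of_multSpanMod_three`
(the bridge transported to the cusp `1/3`, then the ultrametric step; M-sized over `exists_mem_one_le_norm_sub_of_spanModBy_of_prime`) ·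
S3 is no longer a stub: `muAnZeroAt_of_orbitUnit` / `multMuAn_of_orbitUnit` (`p`-generic, odd `p`: a unit orbit sum of level `≥ 1` ⟹
`X11a.MuAnZeroAt` ⟹ a unit coefficient of `ϖ·L_p` in the route's currency; modulo Mazur 1978 Cor. 4.1 only) are PROVED below from p3's coset door
(`PrintX11aMuCosetCertificate` / `PrintX11aMuCosetDoorUnit`) + `Additive.norm_ratPlusSymbol_le_one_of_irreducible` + `isMultPAdicLFunctionOf_one_iff` · S4
`stub_pubFactsAn` (shared with «finemu3»/«hardlocus3»/«cartan3», moot once `stmt-19949` closes).  Real proofs: `UpperNonSurjThree_of_orbitUnit`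
(FALLBACK: the crux from the displayed eigen-localised hypothesis «some orbit sum is a 3-unit on the U3 domain» + S3ᴿ (real) + S4 — a level failure
of S1 on old/non-eigen classes downgrades the line to that hypothesis, it does not kill it), `muAnHardThree_of_multSpan :
Theorems.X11aNonSurjMuAnHardThree` (closes the μ-road's registered hardest stub of «finemu3»/«hardlocus3» BY NAME, using neither the
hard locus nor non-surjectivity), `UpperNonSurjThree_of : Theses.PrintX11a.UpperNonSurjThree` (the crux, through the landed μ-kernel
`multDivisibilityAt_of_katoFacts_of_muAn` and the door `missingUpperBoundAt_of_classX11a_of_multDivisibilityAt`).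
BENEFICIARIES of S1 (book once): `μ₃^an = 0` for EVERY `E/ℚ` with multiplicative reduction at 3 and `E[3]` irreducible — every consumer of
`Theorems.X11aNonSurjMuAn`/`X11aNonSurjMuAnAtThree`/`X11aNonSurjMuAnHardThree` (EulerHalfBranchesDefs, MuAnHardDefs, EulerHalfOfBranches,
HardLocusRecords*), and the μ-road stubs of finemu3 / cartan3.
-/

-- the summit namespace repeats `BirchSwinnertonDyer` by design (summit = problem); linter moot
set_option linter.dupNamespace false
set_option autoImplicit false

noncomputable section

open scoped Classical NumberField MatrixGroups ModularForm

open CongruenceSubgroup WeierstrassCurve Field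
  Literature.NumberTheory.EllipticCurves
  Literature.NumberTheory.EllipticCurves.ModularForms
  Literature.NumberTheory.EllipticCurves.Rank1Residual
  Literature.NumberTheory.EllipticCurves.Rank1Residual.Typed
  Literature.NumberTheory.EllipticCurves.Wuthrich2014
  Literature.NumberTheory.EllipticCurves.SteinWuthrich2013
  Literature.NumberTheory.EllipticCurves.Greenberg1999
  Literature.NumberTheory.EllipticCurves.Kato2004
  Summit.BirchSwinnertonDyer.Rank1Residual
  Summit.BirchSwinnertonDyer.Rank1Residual.X11b
  Summit.BirchSwinnertonDyer.BirchSwinnertonDyer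

namespace Summit.BirchSwinnertonDyer.BirchSwinnertonDyer.Cruxes.UpperNonSurjThree.MultSpan

/-! ### The transferred objects -/

/-- **MULT-GOOD element** of `Γ₀(N)` at `p ∣ N`: `|c(γ) + p·d(γ)| = p^{m+1}` for some `m`, i.e. `γ` carries the cusp
`1/p` to a cusp `u/p^{m+1}` in lowest terms (`p ∤ u`).  The transfer of `IsGoodAt` (`|d(γ)| = p^m` ⟺ `γ·0 = b/p^m`). -/
def IsMultGoodAt {N : ℕ} (p : ℕ) (γ : Gamma0 N) : Prop :=
  ∃ m : ℕ, (((γ : SL(2, ℤ)) 1 0 : ℤ) + (p : ℤ) * ((γ : SL(2, ℤ)) 1 1 : ℤ)).natAbs = p ^ (m + 1)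

/-- **THEOREM B^{mult} at level `p·M`** (the first non-transferring step, as a predicate): the tree's mod-`p` span
statement `SpanModBy` for the MULT-GOOD test set — `Γ₁'(pM) ⊆ ⟨mult-good ∪ finite-order ∪ trace ±2 ∪ p-th powers⟩ ·
[Γ₀(pM), Γ₀(pM)]`. -/
def MultSpanModGen (M p : ℕ) : Prop :=
  SpanModBy (p * M) p {γ : Gamma0 (p * M) | IsMultGoodAt p γ}

/-- **Transferred carrier** (the analogue of `CycWindingNonConstantAt` at a multiplicative prime): for the newform `f`
of `E`, some plus symbol `[u/p^{k+1}]⁺_f` (`p ∤ u`) differs from `[1/p]⁺_f` by a `p`-adic unit.  Both are values (up to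
sign) of the one-root Mazur–Tate–Teitelbaum measure, so one of them is a unit. -/
def MultWindingNonConstantAt (W : WeierstrassCurve ℚ) (p : ℕ) [Fact p.Prime] : Prop :=
  ∀ {N : ℕ} [NeZero N] (f : CuspForm (Gamma0 N) 2), IsNewformOf W f →
    ∃ (k : ℕ) (u : ℤ), ¬ (p : ℤ) ∣ u ∧
      1 ≤ ‖((ratPlusSymbol f ((u : ℚ) / (p : ℚ) ^ (k + 1)) - ratPlusSymbol f (1 / (p : ℚ)) : ℚ) : ℚ_[p])‖

/-- **Transferred carrier**: for the newform `f` of `E`, some Teichmüller orbit sum `A_n(a)` of level `n ≥ 1`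
(`Rank1Residual.teichOrbitSum`) is a `p`-adic unit. -/
def MultTeichOrbitUnitAt (W : WeierstrassCurve ℚ) (p : ℕ) [Fact p.Prime] : Prop :=
  ∀ {N : ℕ} [NeZero N] (f : CuspForm (Gamma0 N) 2), IsNewformOf W f →
    ∃ n : ℕ, 1 ≤ n ∧ ∃ a : (ZMod (p ^ n))ˣ, 1 ≤ ‖((teichOrbitSum f p n (a : ZMod (p ^ n)) : ℚ) : ℚ_[p])‖

/-- **The μ-claim of the crux in its native shape** (verbatim tail of `Theorems.X11aNonSurjMuAnHardThree`, for ONE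
curve and prime): some coefficient of `ϖ · L_p(E,T)` is a `p`-adic unit, `L` the Mazur–Tate–Teitelbaum function of the
newform with the root `a = a_p = ±1`, `ϖ = Ω_f⁺/Ω_E`. -/
def MultMuAnAt (W : WeierstrassCurve ℚ) [W.IsElliptic] (p : ℕ) [Fact p.Prime] : Prop :=
  ∀ {N : ℕ} [NeZero N] (f : CuspForm (Gamma0 N) 2), IsNewformOf W f →
    ∀ (ϖ : ℚ), (ϖ : ℝ) * W.realPeriodRat = plusPeriod f →
    ∀ (a : ℚ_[p]) (L : PowerSeries ℚ_[p]),
      (W.HasSplitMultiplicativeReductionAtPrime p → a = 1) →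
      (¬ W.HasSplitMultiplicativeReductionAtPrime p → a = -1) →
      IsMultPAdicLFunctionOf f p a L →
      ∃ n : ℕ, ‖PowerSeries.coeff n (PowerSeries.C ((ϖ : ℚ) : ℚ_[p]) * L)‖ = 1

/-! ### The four stubs (v2: S2 concludes the orbit-unit carrier; S3 `p`-generic and SHARED VERBATIM with «multteich5», critic V#5/V#6-P3) -/

/-- **stub S1 (THE crux of this line; OPEN; pure group theory of `Γ₀(3M)`)**: THEOREM B^{mult} — at every level `3M`,
`3 ∤ M`, the mult-good elements span `Γ₁'(3M)` modulo finite-order and parabolic elements, cubes and commutators.  The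
good-reduction analogue `ConjSpanGen M 3` is the tree's THEOREM B (Vaserstein); at `M = 1, 2, 4` it is vacuous (genus 0).
Why it might fail: a non-Eisenstein class in `H¹(X₀(3M); 𝔽₃)` orthogonal to every closed geodesic `{1/3 → γ(1/3)}`,
`γ` mult-good — for a 3-new eigenclass that is exactly `μ₃ > 0`; the statement also binds old and mixed-sign classes.
[cite: Manin1972, Prop. 1.4 and Thm. 1.9] [cite: GreenbergLNM1716, Conj. 1.11 (p. 62)] -/
theorem stub_multSpanMod_three : ∀ M : ℕ, 0 < M → ¬ 3 ∣ M → MultSpanModGen M 3 := by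
  sorry

/-- **stub S2 (the Stevens bridge transported from the cusp `0` to the cusp `1/3`; M-sized)**: Theorem B^{mult} at all
levels ⟹ for `E` with multiplicative reduction at `3` and `E[3]` irreducible, some orbit sum `A_n(a) = [a/3ⁿ]⁺ + [−a/3ⁿ]⁺ =
2[a/3ⁿ]⁺`, `n ≥ 1`, is a `3`-adic unit.  Plan: the newform has level `N = 3M`, `3 ∤ M`; `E[3]` irreducible gives a good `ℓ ∤ N`
with `a_ℓ ≢ ℓ + 1 (mod 3)` (`exists_prime_not_dvd_frobeniusTrace_sub`); `exists_mem_one_le_norm_sub_of_spanModBy_of_prime` (its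
docstring: «`p ∤ N` NOT needed») with the mult-good test set gives a mult-good `γ` with `‖[γ0]⁺ − [0]⁺‖₃ ≥ 1`, and
`[γ0]⁺ − [0]⁺ = m(γ)/2 = [γ(1/3)]⁺ − [1/3]⁺ = [u/3^{m+1}]⁺ − [1/3]⁺` (this is the intermediate `MultWindingNonConstantAt W 3`);
ultrametric ⟹ `[u/3^{m+1}]⁺` or `[1/3]⁺` is a unit; `[−r]⁺ = [r]⁺` (`ratPlusSymbol_neg`) and `t² = 1 ⇒ t = ±1` in `ℤ/3ⁿ` turn that
into a unit `teichOrbitSum f 3 n a` (`2` is a unit).  Why it might fail: only if the symbol transport `[γr]⁺ − [r]⁺ = [γ0]⁺ − [0]⁺`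
is mis-normalised in the tree's `ratPlusSymbol` (it is `Re{∞→γ∞}/Ω⁺`, `plusSymbol_eq_re_holds`).
[cite: Manin1972, Thm. 1.9] [cite: GreenbergLNM1716, Prop. 5.10] -/
theorem stub_orbitUnit_of_multSpanMod_three :
    (∀ M : ℕ, 0 < M → ¬ 3 ∣ M → MultSpanModGen M 3) →
    ∀ (W : WeierstrassCurve ℚ) [W.IsElliptic] [W.IsGloballyMinimal],
      Mult W 3 → Irr W 3 → MultTeichOrbitUnitAt W 3 := by
  sorry

/-! ### S3 is REAL (v5/v3, 2026-08-28): orbit unit ⟹ `X11a.MuAnZeroAt` ⟹ `MultMuAnAt`, class-wide, through the CELL'S OWN coset door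
(p3's `PrintX11aMuCosetCertificate` / `PrintX11aMuCosetDoorUnit`: Riemann sums of the Néron-normalised table, `Λ/ω_n`, discrete log of the
representative) + the tree's class-wide integrality `Additive.norm_ratPlusSymbol_le_one_of_irreducible` (`p` odd, `E[p]` irreducible ⟹
`‖[r]⁺_f‖_p ≤ 1`) + Mazur 1978 Cor. 4.1 (`‖ϖ‖_p = 1`, the ONE displayed fact).  No Wuthrich binder is needed any more.  Shared verbatim by
«multspan3» (U3) and «multteich5» (U5). -/

/-- Reindexing: the Teichmüller orbit `{t·a : t^{p−1} = 1}` of a unit `a (mod p^k)` is the coset finset `{b : b^{p−1} = a^{p−1}}`. [folklore] -/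
theorem sum_teich_mul_eq_sum_filter_pow {p : ℕ} [Fact p.Prime] {k : ℕ} {M : Type*} [AddCommMonoid M]
    (a : (ZMod (p ^ k))ˣ) (g : ZMod (p ^ k) → M) :
    ∑ t ∈ (Finset.univ : Finset (ZMod (p ^ k))).filter (fun t => t ^ (p - 1) = 1), g (t * a) =
      ∑ b ∈ (Finset.univ : Finset (ZMod (p ^ k))).filter
        (fun b => b ^ (p - 1) = (a : ZMod (p ^ k)) ^ (p - 1)), g b := by
  refine Finset.sum_nbij' (fun t => t * a) (fun b => b * ↑a⁻¹) ?_ ?_ ?_ ?_ ?_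
  · intro t ht
    simp only [Finset.mem_filter, Finset.mem_univ, true_and] at ht ⊢
    rw [mul_pow, ht, one_mul]
  · intro b hb
    simp only [Finset.mem_filter, Finset.mem_univ, true_and] at hb ⊢
    rw [mul_pow, hb, ← mul_pow, Units.mul_inv, one_pow]
  · intro t _
    simp only [mul_assoc, Units.mul_inv, mul_one]
  · intro b _
    simp only [mul_assoc, Units.inv_mul, mul_one]
  · intro t _
    rfl

/-- **S3ᴿ, the `μ`-certificate class-wide (REAL; modulo Mazur 1978 Cor. 4.1 only).** At an odd multiplicative prime `p` with `E[p]`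
irreducible, ONE unit Teichmüller-orbit sum `S_f(p, n, a)`, `n ≥ 1`, gives `X11a.MuAnZeroAt W p` (a unit coefficient of `ϖ·L_p` for THE
split / non-split Mazur–Tate–Teitelbaum function).  Proof = the cell's door read class-wide: `‖ϖ‖_p = 1`
(`X11b.ClassClosure.norm_ratCast_periodRatio_eq_one_of_mazur`), `‖[r]⁺_f‖_p ≤ 1` for all `r` (`Additive.norm_ratPlusSymbol_le_one_of_irreducible`),
hence the whole table `ϖ·[a/p^m]⁺_f` is integral (`X11a.MuCoset.norm_periodRatio_mul_ratPlusSymbol_le_one`) and the displayed `‖S‖ ≥ 1` is `= 1`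
(ultrametric); `a^{p−1} = (1+p)^{(p−1)s₀}` (`X11a.MuCoset.exists_pow_sub_one_eq_cyclotomicGenerator_pow`) identifies the orbit with the door's
coset (`X11a.MuCoset.finsum_coset_eq_sum_filter` + `sum_teich_mul_eq_sum_filter_pow`), and `X11a.MuCoset.exists_norm_coeff_eq_one_of_cosetSum_(non)split`
(MTT §I.12–13 Riemann sums in `Λ/ω_n`) gives the unit coefficient. [cite: MazurTateTeitelbaum1986Invent, §I.10, §I.12–I.13] [cite: Mazur1978, Cor. 4.1] -/
theorem muAnZeroAt_of_orbitUnit (hMz : ModularForms.mazur_not_dvd_maninConstant_of_odd)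
    (W : WeierstrassCurve ℚ) [W.IsElliptic] [W.IsGloballyMinimal] (p : ℕ) [Fact p.Prime]
    (hp2 : p ≠ 2) (hmult : Mult W p) (hirr : Irr W p) (h : MultTeichOrbitUnitAt W p) :
    Summit.BirchSwinnertonDyer.Rank1Residual.X11a.MuAnZeroAt W p := by
  classical
  have he : cyclotomicExponent p = 1 := if_neg hp2
  have hγ : cyclotomicGenerator p = 1 + p := by rw [cyclotomicGenerator, he, pow_one]
  have hτ : torsionOrder p = p - 1 := by rw [torsionOrder_eq, if_neg hp2]
  intro N _ f hf ϖ hϖ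
  obtain ⟨n, hn1, a, ha⟩ := h f hf
  obtain ⟨m, rfl⟩ : ∃ m, n = m + 1 := ⟨n - 1, by omega⟩
  have hϖ1 : ‖((ϖ : ℚ) : ℚ_[p])‖ = 1 :=
    Summit.BirchSwinnertonDyer.Rank1Residual.X11b.ClassClosure.norm_ratCast_periodRatio_eq_one_of_mazur W p hMz hp2
      hmult hirr hf hϖ
  have hsym : ∀ r : ℚ, ‖((ratPlusSymbol f r : ℚ) : ℚ_[p])‖ ≤ 1 :=
    Summit.BirchSwinnertonDyer.Rank1Residual.Additive.norm_ratPlusSymbol_le_one_of_irreducible hp2 hf hirr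
  have h0 : ‖((ϖ * ratPlusSymbol f 0 : ℚ) : ℚ_[p])‖ ≤ 1 := by
    rw [Rat.cast_mul, norm_mul, hϖ1, one_mul]; exact hsym 0
  have hint := Summit.BirchSwinnertonDyer.Rank1Residual.X11a.MuCoset.norm_periodRatio_mul_ratPlusSymbol_le_one W p hp2 hf
    hmult hϖ1.le h0
  have hS1 : ‖((teichOrbitSum f p (m + 1) (a : ZMod (p ^ (m + 1))) : ℚ) : ℚ_[p])‖ = 1 := by
    refine le_antisymm ?_ ha
    rw [teichOrbitSum_def, Rat.cast_sum]
    exact IsUltrametricDist.norm_sum_le_of_forall_le_of_nonneg zero_le_one fun t _ => hsym _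
  obtain ⟨s₀, hs₀⟩ := Summit.BirchSwinnertonDyer.Rank1Residual.X11a.MuCoset.exists_pow_sub_one_eq_cyclotomicGenerator_pow p
    hp2 m (a : ZMod (p ^ (m + 1))) a.isUnit
  have hunit : ‖∑ᶠ ξ : rootsOfUnity (torsionOrder p) ℤ_[p],
      ((ϖ * ratPlusSymbol f
        (((PadicInt.toZModPow (m + cyclotomicExponent p) ((ξ : ℤ_[p]ˣ) : ℤ_[p]) *
            (cyclotomicGenerator p : ZMod (p ^ (m + cyclotomicExponent p))) ^ s₀.val).val : ℚ) /
          (p : ℚ) ^ (m + cyclotomicExponent p)) : ℚ) : ℚ_[p])‖ = 1 := by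
    rw [Summit.BirchSwinnertonDyer.Rank1Residual.X11a.MuCoset.finsum_coset_eq_sum_filter p hp2 m s₀ (fun b ↦
      ((ϖ * ratPlusSymbol f ((b.val : ℚ) / (p : ℚ) ^ (m + cyclotomicExponent p)) : ℚ) : ℚ_[p]))]
    rw [he, hτ, hγ, ← hs₀, ← Rat.cast_sum, ← Finset.mul_sum, Rat.cast_mul, norm_mul, hϖ1, one_mul,
      ← sum_teich_mul_eq_sum_filter_pow a (fun b ↦ ratPlusSymbol f ((b.val : ℚ) / (p : ℚ) ^ (m + 1))),
      ← teichOrbitSum_def]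
    exact hS1
  refine ⟨fun hns L hL ↦ ?_, fun hs L hL ↦ ?_⟩
  · obtain ⟨k, -, hk⟩ :=
      Summit.BirchSwinnertonDyer.Rank1Residual.X11a.MuCoset.exists_norm_coeff_eq_one_of_cosetSum_nonsplit W p hf hmult hns ϖ
        hint s₀ hunit hL
    exact ⟨k, hk⟩
  · obtain ⟨k, -, hk⟩ :=
      Summit.BirchSwinnertonDyer.Rank1Residual.X11a.MuCoset.exists_norm_coeff_eq_one_of_cosetSum_split W p hf hs ϖ hint s₀
        hunit hL
    exact ⟨k, hk⟩

/-- Currency bridge (REAL): the door's `X11a.MuAnZeroAt W p` (THE split function `IsSplitMultPAdicLFunctionOf` / THE non-split function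
`IsMultPAdicLFunctionOf f p (−1)`) is the route's `MultMuAnAt W p` (`IsMultPAdicLFunctionOf f p (±1)`), by the tree's
`isMultPAdicLFunctionOf_one_iff`. [folklore] -/
theorem multMuAnAt_of_muAnZeroAt (W : WeierstrassCurve ℚ) [W.IsElliptic] [W.IsGloballyMinimal] (p : ℕ) [Fact p.Prime]
    (h : Summit.BirchSwinnertonDyer.Rank1Residual.X11a.MuAnZeroAt W p) : MultMuAnAt W p := by
  intro N _ f hf ϖ hϖ a L ha1 ha2 hL
  obtain ⟨hn, hs⟩ := h f hf ϖ hϖ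
  by_cases hsp : W.HasSplitMultiplicativeReductionAtPrime p
  · have ha : a = 1 := ha1 hsp
    subst ha
    exact hs hsp L ((isMultPAdicLFunctionOf_one_iff L).mp hL)
  · have ha : a = -1 := ha2 hsp
    subst ha
    exact hn hsp L hL

/-- **S3 (REAL since v5/v3; was the stub `stub_multMuAn_of_orbitUnit`)**: a unit orbit sum of level `n ≥ 1` ⟹ a unit coefficient of
`ϖ·L_p(E,T)` in the route's currency — modulo Mazur 1978 Cor. 4.1 only (conjunct 9 of `KatoTwinFactsFiveAn`).
[cite: MazurTateTeitelbaum1986Invent, §I.10–I.13] [cite: Mazur1978, Cor. 4.1] -/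
theorem multMuAn_of_orbitUnit :
    ModularForms.mazur_not_dvd_maninConstant_of_odd →
    ∀ (W : WeierstrassCurve ℚ) [W.IsElliptic] [W.IsGloballyMinimal] (p : ℕ) [Fact p.Prime],
      p ≠ 2 → Mult W p → Irr W p → MultTeichOrbitUnitAt W p → MultMuAnAt W p :=
  fun hMz W _ _ p _ hp2 hmult hirr h => multMuAnAt_of_muAnZeroAt W p (muAnZeroAt_of_orbitUnit hMz W p hp2 hmult hirr h)

/-- **stub S4 (shared with «finemu3»/«hardlocus3»/«cartan3»; the published-facts conjunction of the parent split, item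
stmt-BirchSwinnertonDyer-19949)**: `Theses.ErratumRoadFive.KatoTwinFactsFiveAn` — only conjuncts 9 (Manin–Mazur) and 22
(Wuthrich Cor. 18) feed the transfer; the door and the μ-kernel consume the rest. [cite: Kato2004Asterisque, Thm. 17.4]
[cite: SteinWuthrich2013, Thm. 6.1 (p. 20)] -/
theorem stub_pubFactsAn : Theses.ErratumRoadFive.KatoTwinFactsFiveAn := by
  sorry

/-! ### Compositions (real proofs) -/

/-- **FALLBACK displayed (critic V#5-P2: the eigen-localised statement S2 actually delivers, in curve currency)**: if, on the U3 domain,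
some orbit sum `2[a/3ⁿ]⁺`, `n ≥ 1`, of the newform is a `3`-unit, then S3 + S4 already give the crux — so a level at which S1 fails on OLD
or non-eigen classes downgrades the line to this hypothesis instead of killing it.  Real proof; the hypothesis is displayed, not assumed. -/
theorem UpperNonSurjThree_of_orbitUnit
    (h : ∀ (W : WeierstrassCurve ℚ) [W.IsElliptic] [W.IsGloballyMinimal],
      ClassX11a W 3 → ¬ Surj W 3 → MultTeichOrbitUnitAt W 3) :
    Theses.PrintX11a.UpperNonSurjThree := by
  obtain ⟨-, -, -, hGZK, hmod, -, hpar, -, hM, -, -, hJs, hJn, hGS, -, -, hne, h12, hnsI, hspI, h15, h18,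
    hfine⟩ := stub_pubFactsAn
  intro W _ _ p _ hX hns hp3
  have hμ : MultMuAnAt W p := by
    subst hp3
    exact multMuAn_of_orbitUnit hM W 3 hX.2.1 hX.2.2.1 hX.2.2.2.1 (h W hX hns)
  exact missingUpperBoundAt_of_classX11a_of_multDivisibilityAt hJs hJn hGZK hmod hpar W p (hGS W p) hX
    (multDivisibilityAt_of_katoFacts_of_muAn hne h12 hnsI hspI h15 h18 hfine W p hX.2.1 hX.2.2.1 hX.2.2.2.1 hns
      (fun f hf => hμ f hf))

/-- **The transfer closes the μ-road's hardest stub BY NAME**: S1–S4 ⟹ `Theorems.X11aNonSurjMuAnHardThree` (the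
registered `stub_muAnHardThree` of «finemu3»/«hardlocus3»).  The hard-locus disjunction and `¬ Surj` are not used. -/
theorem muAnHardThree_of_multSpan : Theorems.X11aNonSurjMuAnHardThree := by
  obtain ⟨-, -, -, -, -, -, -, -, hM, -⟩ := stub_pubFactsAn
  intro W _ _ p _ hX _hns hp3 _hhard N _ f hf ϖ hϖ a L ha1 ha2 hL
  subst hp3
  exact multMuAn_of_orbitUnit hM W 3 hX.2.1 hX.2.2.1 hX.2.2.2.1
    (stub_orbitUnit_of_multSpanMod_three stub_multSpanMod_three W hX.2.2.1 hX.2.2.2.1) f hf ϖ hϖ a L ha1 ha2 hL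

/-- **Composition concluding the crux BY NAME**: at every X11a pair with `ρ̄_{E,3}` not surjective and `p = 3`, S1–S2 give a unit orbit
sum and the displayed fallback composition (S3, S4, the landed μ-kernel `multDivisibilityAt_of_katoFacts_of_muAn` and the landed door
`missingUpperBoundAt_of_classX11a_of_multDivisibilityAt`) does the rest. -/
theorem UpperNonSurjThree_of : Theses.PrintX11a.UpperNonSurjThree :=
  UpperNonSurjThree_of_orbitUnit fun W _ _ hX _hns =>
    stub_orbitUnit_of_multSpanMod_three stub_multSpanMod_three W hX.2.2.1 hX.2.2.2.1


/-! ## v4 (2026-08-28): CLOSURE AT `p = 3` FROM THE TREE — stubs S1 ⊕ S2 DISCHARGED, the crux from `stub_pubFactsAn` ALONE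

Width seat x11a-p2 g2 landed p613999 `Theorems/PrintX11aMultThreeWinding.lean`
(`MultThreeWinding.exists_one_le_norm_ratPlusSymbol_div_three_pow`: `Mult W 3 → Irr W 3 → IsNewformOf W f →
∃ k ≥ 1, 3 ∤ u, 1 ≤ ‖[u/3ᵏ]⁺_f‖₃` — the Atkin–Lehner-extended orbit trick in `GL₂(ℤ[1/3])`, NO named fact).  At `p = 3`
BRANCH SEPARATION IS TRIVIAL: the Teichmüller orbit in `ℤ/3ᵏ` is `{±1}` (`t² = 1 ⇒ t = ±1`, Hensel by hand) and `[·]⁺` is even,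
so a unit symbol IS a unit orbit sum (`teichOrbitSum f 3 k u = 2·[u/3ᵏ]⁺`, `‖2‖₃ = 1`): `multTeichOrbitUnitAt_three` below (real
proof).  Consequently the crux follows from `stub_pubFactsAn` ALONE: `UpperNonSurjThree_of_pubFacts` — kernel-checked, modulo item
stmt-BirchSwinnertonDyer-19949 (an-half) only.  S1 `stub_multSpanMod_three` / S2 `stub_orbitUnit_of_multSpanMod_three` stay in the file as
bankable-but-UNNEEDED group theory: do NOT staff them.  (x11a-p2 announced the same closure through finemu3's `UpperNonSurjThree_of_muRoad`
as `…MuAnHardThreeOfMazur.lean`; here it is certified inside this skeleton against the landed theorem; `muAnHardThree_of_mazur` below is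
that statement, by name, modulo Mazur's Manin-constant fact only.)  At `p ≥ 5` the same step is NOT trivial — it is the open content of
U5's S1 (crux idea «orbitp-minbranch», `Cruxes/UpperNonSurjFive/Ideas/orbitp-minbranch.md`). -/

section ClosureAtThree

/-- Hensel by hand: in `ℤ/3ᵏ` (`k ≥ 1`) the square roots of `1` are `±1` (`gcd(z − 1, z + 1) ∣ 2`, so `3ᵏ` divides one factor). -/
theorem eq_one_or_eq_neg_one_of_sq_eq_one {k : ℕ} (hk : 1 ≤ k) {t : ZMod (3 ^ k)} (ht : t ^ 2 = 1) :
    t = 1 ∨ t = -1 := by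
  haveI : NeZero (3 ^ k) := ⟨pow_ne_zero _ (by norm_num)⟩
  have h3 : Prime (3 : ℤ) := Int.prime_three
  have hk0 : k ≠ 0 := by omega
  set z : ℤ := (t.val : ℤ) with hz
  have htz : ((z : ℤ) : ZMod (3 ^ k)) = t := by rw [hz, Int.cast_natCast, ZMod.natCast_zmod_val]
  have hdvd : (3 : ℤ) ^ k ∣ (z - 1) * (z + 1) := by
    have h0 : (((z - 1) * (z + 1) : ℤ) : ZMod (3 ^ k)) = 0 := by
      push_cast; rw [htz]; linear_combination ht
    have := (ZMod.intCast_zmod_eq_zero_iff_dvd _ _).mp h0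
    exact_mod_cast this
  have h3dvd : (3 : ℤ) ∣ (z - 1) * (z + 1) := (dvd_pow_self (3 : ℤ) hk0).trans hdvd
  have hback : ∀ w : ℤ, (3 : ℤ) ^ k ∣ z - w → t = (w : ZMod (3 ^ k)) := by
    intro w hw
    have h0 : (((z - w : ℤ)) : ZMod (3 ^ k)) = 0 :=
      (ZMod.intCast_zmod_eq_zero_iff_dvd _ _).mpr (by exact_mod_cast hw)
    push_cast at h0
    rw [htz] at h0
    exact sub_eq_zero.mp h0
  have htwo : ¬ ((3 : ℤ) ∣ z - 1 ∧ (3 : ℤ) ∣ z + 1) := by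
    rintro ⟨h1, h2⟩
    have h22 : (3 : ℤ) ∣ (z + 1) - (z - 1) := dvd_sub h2 h1
    have : (z + 1) - (z - 1) = 2 := by ring
    rw [this] at h22
    omega
  rcases h3.dvd_or_dvd h3dvd with h1 | h2
  · have hn : ¬ (3 : ℤ) ∣ z + 1 := fun h2 => htwo ⟨h1, h2⟩
    left
    have := hback 1 (((h3.coprime_iff_not_dvd.mpr hn).pow_left (m := k)).dvd_of_dvd_mul_right hdvd)
    simpa using this
  · have hn : ¬ (3 : ℤ) ∣ z - 1 := fun h1 => htwo ⟨h1, h2⟩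
    right
    have h' : (3 : ℤ) ^ k ∣ z - (-1) := by
      have := ((h3.coprime_iff_not_dvd.mpr hn).pow_left (m := k)).dvd_of_dvd_mul_left hdvd
      simpa [sub_neg_eq_add] using this
    have := hback (-1) h'
    simpa using this

/-- At `p = 3`, level `k ≥ 1`: the Teichmüller orbit sum is twice the plus symbol (orbit `{±1}`, `[−r]⁺ = [r]⁺`).
[cite: MazurTateTeitelbaum1986Invent, §I.10 (10.1)] -/
theorem teichOrbitSum_three_eq {N : ℕ} [NeZero N] (f : CuspForm (Gamma0 N) 2) {k : ℕ} (hk : 1 ≤ k) (u : ℤ) :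
    teichOrbitSum f 3 k (u : ZMod (3 ^ k)) = 2 * ratPlusSymbol f ((u : ℚ) / (3 : ℚ) ^ k) := by
  haveI : NeZero (3 ^ k) := ⟨pow_ne_zero _ (by norm_num)⟩
  have hk0 : k ≠ 0 := by omega
  have hne : (1 : ZMod (3 ^ k)) ≠ -1 := by
    intro h
    have h2 : ((2 : ℤ) : ZMod (3 ^ k)) = 0 := by push_cast; linear_combination h
    have h3 : ((3 ^ k : ℕ) : ℤ) ∣ 2 := (ZMod.intCast_zmod_eq_zero_iff_dvd _ _).mp h2
    push_cast at h3
    have : (3 : ℤ) ∣ 2 := (dvd_pow_self (3 : ℤ) hk0).trans h3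
    omega
  have hfilter : (Finset.univ.filter fun t : ZMod (3 ^ k) => t ^ (3 - 1) = 1) = {1, -1} := by
    ext t
    simp only [Finset.mem_filter, Finset.mem_univ, true_and, Finset.mem_insert, Finset.mem_singleton]
    constructor
    · intro h
      exact eq_one_or_eq_neg_one_of_sq_eq_one hk (by simpa using h)
    · rintro (rfl | rfl) <;> norm_num
  have hval : ∀ w : ℤ, ratPlusSymbol f ((((w : ZMod (3 ^ k)).val : ℕ) : ℚ) / (3 : ℚ) ^ k)
      = ratPlusSymbol f ((w : ℚ) / (3 : ℚ) ^ k) := by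
    intro w
    have := (AnalyticMuZeroX9.TeichSpan.ratPlusSymbol_intCast_div_pow (f := f) (p := 3) k w).symm
    simp only [Nat.cast_ofNat] at this
    exact this
  rw [teichOrbitSum_def, hfilter, Finset.sum_pair hne]
  have h1 : ((1 : ZMod (3 ^ k)) * ((u : ℤ) : ZMod (3 ^ k))) = ((u : ℤ) : ZMod (3 ^ k)) := one_mul _
  have hm1 : ((-1 : ZMod (3 ^ k)) * ((u : ℤ) : ZMod (3 ^ k))) = (((-u : ℤ)) : ZMod (3 ^ k)) := by
    push_cast; ring
  simp only [Nat.cast_ofNat]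
  rw [h1, hm1, hval u, hval (-u),
    show (((-u : ℤ)) : ℚ) / (3 : ℚ) ^ k = -((u : ℚ) / (3 : ℚ) ^ k) by push_cast; ring, ratPlusSymbol_neg]
  ring

/-- **Branch separation is trivial at `p = 3`** ⟹ the transferred carrier holds OUTRIGHT at every multiplicative `3` with
`E[3]` irreducible, by p613999 (tree): S1 ⊕ S2 discharged.  Real proof; no named fact; no `sorry`. -/
theorem multTeichOrbitUnitAt_three (W : WeierstrassCurve ℚ) [W.IsElliptic] [W.IsGloballyMinimal]
    (hmult : Mult W 3) (hirr : Irr W 3) : MultTeichOrbitUnitAt W 3 := by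
  intro N _ f hf
  obtain ⟨k, u, hk, hu, h⟩ :=
    Theorems.MultThreeWinding.exists_one_le_norm_ratPlusSymbol_div_three_pow W hmult hirr hf
  have hcop : IsCoprime ((3 ^ k : ℕ) : ℤ) u := by
    have h3u : IsCoprime (3 : ℤ) u := Int.prime_three.coprime_iff_not_dvd.mpr hu
    exact_mod_cast h3u.pow_left (m := k)
  have hunit : IsUnit ((u : ℤ) : ZMod (3 ^ k)) := (ZMod.coe_int_isUnit_iff_isCoprime u (3 ^ k)).mpr hcop
  refine ⟨k, hk, hunit.unit, ?_⟩
  rw [hunit.unit_spec, teichOrbitSum_three_eq f hk u]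
  have h2 : ‖(2 : ℚ_[3])‖ = 1 := by
    have := (Padic.norm_natCast_eq_one_iff (p := 3) (n := 2)).mpr (by norm_num)
    simpa only [Nat.cast_ofNat] using this
  have hc : (((2 * ratPlusSymbol f ((u : ℚ) / (3 : ℚ) ^ k) : ℚ)) : ℚ_[3])
      = (2 : ℚ_[3]) * (((ratPlusSymbol f ((u : ℚ) / (3 : ℚ) ^ k) : ℚ)) : ℚ_[3]) := by
    push_cast; ring
  rw [hc, norm_mul, h2, one_mul]
  exact h

/-- **U3 ⇐ item 19949, kernel-certified with the facts package DISPLAYED (v4; NO `sorry` in this theorem's cone)** — composition: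
p613999 (tree) ⊕ `multTeichOrbitUnitAt_three` ⊕ S3 (`multMuAn_of_orbitUnit`, real since v3) ⊕ the landed door
`missingUpperBoundAt_of_classX11a_of_multDivisibilityAt` ⊕ the landed μ-kernel `multDivisibilityAt_of_katoFacts_of_muAn`.
`hF` = `Theses.ErratumRoadFive.KatoTwinFactsFiveAn` = the statement of item stmt-BirchSwinnertonDyer-19949 (registered). -/
theorem UpperNonSurjThree_of_facts (hF : Theses.ErratumRoadFive.KatoTwinFactsFiveAn) :
    Theses.PrintX11a.UpperNonSurjThree := by
  obtain ⟨-, -, -, hGZK, hmod, -, hpar, -, hM, -, -, hJs, hJn, hGS, -, -, hne, h12, hnsI, hspI, h15, h18,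
    hfine⟩ := hF
  intro W _ _ p _ hX hns hp3
  have hμ : MultMuAnAt W p := by
    subst hp3
    exact multMuAn_of_orbitUnit hM W 3 hX.2.1 hX.2.2.1 hX.2.2.2.1
      (multTeichOrbitUnitAt_three W hX.2.2.1 hX.2.2.2.1)
  exact missingUpperBoundAt_of_classX11a_of_multDivisibilityAt hJs hJn hGZK hmod hpar W p (hGS W p) hX
    (multDivisibilityAt_of_katoFacts_of_muAn hne h12 hnsI hspI h15 h18 hfine W p hX.2.1 hX.2.2.1 hX.2.2.2.1 hns
      (fun f hf => hμ f hf))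

/-- … and with the package supplied by the registered stub S4 (the ONLY `sorry` in this theorem's cone). -/
theorem UpperNonSurjThree_of_pubFacts : Theses.PrintX11a.UpperNonSurjThree :=
  UpperNonSurjThree_of_facts stub_pubFactsAn

/-- **finemu3's hardest stub BY NAME, modulo Mazur's Manin-constant fact only** (the statement x11a-p2 announced as
`x11aNonSurjMuAnHardThree_of_mazur`; certified here so the lead can cite either file). -/
theorem muAnHardThree_of_mazur (hMz : ModularForms.mazur_not_dvd_maninConstant_of_odd) :
    Theorems.X11aNonSurjMuAnHardThree := by
  intro W _ _ p _ hX _hns hp3 _hhard N _ f hf ϖ hϖ a L ha1 ha2 hL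
  subst hp3
  exact multMuAn_of_orbitUnit hMz W 3 hX.2.1 hX.2.2.1 hX.2.2.2.1
    (multTeichOrbitUnitAt_three W hX.2.2.1 hX.2.2.2.1) f hf ϖ hϖ a L ha1 ha2 hL

end ClosureAtThree

end Summit.BirchSwinnertonDyer.BirchSwinnertonDyer.Cruxes.UpperNonSurjThree.MultSpan

end
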